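import Literature.NumberTheory.PAdicHodge.AinfWeierstrassEtaPeriod
import Literature.NumberTheory.PAdicHodge.AinfWeierstrassTateModule
import HarnessLib

/-!
# Fontaine's element of a `p`-power DIVISION sequence of a point of `Ŵ(𝔪_{ℂ_F})` and the Kummer cocycle it carries

Topic `Literature/NumberTheory/PAdicHodge`; namespace `Literature.NumberTheory.PAdicHodge.AinfTop`. First floor of brick (K1)
«Kummer classes die in `H¹(F, B⁺_dR ⊗ V_pW)`» of the hT₂ programme of crux K★ `stmt-BirchSwinnertonDyer-22226`
(`Summits/…/Cruxes/StarredOptimalManinUnitFiveSeven/Lines/kato-lever-hT2-programme.md` §4 K1) and of Kato II Lemma 1.4.3: for an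
integral Weierstrass equation `W/ℤ`, a `p`-adic field `F` and a `[p]`-DIVISION sequence `u = (uₙ)` of points of `Ŵ(𝔪_{ℂ_F})`
(`[p]u_{n+1} = uₙ`, `u₀ = P` ARBITRARY — e.g. an `F`-rational point of the formal group):

* §1 (over `𝔪_{ℂ_F}`) the termwise negative `⊖u` and the **Kummer torsion sequence** `κ_u(σ) := (σuₙ ⊖_W uₙ)ₙ` of `σ ∈ Γ_F`:
  `[p]`-compatible (`mulPC_negSeq`, `mulPC_kummerSeq`), `κ_u(σ)₀ = 0` when `u₀` is `σ`-fixed (`coe_kummerSeq_zero`);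
* §2 **Fontaine's integration of `u`**: the tree's `torsionLift W hθ u` (`= lim [pⁿ]_W(ûₙ) ∈ 𝔫 ⊂ 𝔸_inf`; its construction never used
  `u₀ = 0`) packaged as a point `divisionLiftPt W hθ u ∈ Ŵ(𝔫)` with **`θ([ũ]) = u₀`** (`thetaPt_divisionLiftPt`), `Γ_F`-equivariance
  (`galPtN_divisionLiftPt : σ[ũ] = [σu]`), **additivity** `[u ⊕ u'] = [ũ] + [ũ']` in the group `Ŵ(𝔫)` (`divisionLiftPt_addSeq`, from
  `torsionLift_addSeq`), `[0] = 0`, `[⊖u] = −[ũ]`, and **`(σ − 1)[ũ] = [κ_u(σ)]`** (`divisionLiftPt_kummerSeq`): Fontaine's element of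
  the Kummer TORSION sequence is the Galois coboundary of the integral `[ũ]`;
* §3 the **Kummer cocycle** `kummerCocycle W u hup hu₀ : Γ_F → T_pŴ(𝒪_{ℂ_F})`, `σ ↦ κ_u(σ)` (tree `ofSeq`) for `Γ_F`-fixed `u₀`, its
  cocycle law `κ_u(στ) = κ_u(σ) + σ•κ_u(τ)` (`kummerCocycle_mul`) and `torsionLiftHom (κ_u σ) = σ[ũ] − [ũ]` (`torsionLiftHom_kummerCocycle`).

What is NOT here (the open floors of K1): the evaluation of `log_W` / `η₀` at `ι[ũ] ∉ Fil¹` (needs the `(p, ξ)`-adic topology of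
`B_dR⁺`, not the `ξ`-adic one), the period linear algebra in `B_dR ⊗ V`, and the `Fil⁰`-membership of the integrating element (BK
Lemma 3.8.1). Definitions (reviewed): `negSeq`, `kummerSeq`, `divisionLiftPt`, `kummerCocycle`. BSD / K★ are not proved by any of this.

## References
* J.-M. Fontaine, *Le corps des périodes p-adiques*, Astérisque 223 (1994), Exp. II §1.2.2. [FontaineAsterisque223III]
* S. Bloch, K. Kato, *L-functions and Tamagawa numbers of motives* (1990), Ex. 3.10.1, (3.11.1). [BlochKato1990]
* K. Kato, LNM 1553 (1993), Ch. II Lemma 1.4.3. [Kato1993LNM1553]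
* J. H. Silverman, *AEC* (2009), IV.2.3, VIII.§2 (the Kummer pairing). [SilvermanAEC2009]
-/

noncomputable section

open Ideal Filter Topology Field WittVector MvPowerSeries ValuativeRel

namespace Literature.NumberTheory.PAdicHodge

open Literature.NumberTheory.GaloisRepresentations
open Literature.NumberTheory.GaloisRepresentations.IsNonarchimedeanLocalField
open Literature.NumberTheory.GaloisRepresentations.LubinTate
open Literature.NumberTheory.EllipticCurves

namespace AinfTop

/-! ## §1 Over `𝔪_{ℂ_F}`: negatives and the Kummer torsion sequence -/

section PointsC

variable {F : Type} [Field F] [ValuativeRel F] [TopologicalSpace F] [IsNonarchimedeanLocalField F] {p : ℕ}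
  (W : WeierstrassCurve ℤ)

/-- `[p]_W(0) = 0` on `Ŵ(𝔪_{ℂ_F})` (`p • O = O`). [cite: SilvermanAEC2009, IV.2.3] -/
theorem mulPC_zero : mulPC F p W (0 : (maxNilIdealC F).toIdeal) = 0 := by
  have h := val_p_nsmul F W (p := p) (0 : W.Pt (maxNilIdealC F))
  rw [nsmul_zero] at h
  exact h.symm

/-- The termwise formal-group negative `n ↦ ⊖_W uₙ` of a sequence of points of `Ŵ(𝔪_{ℂ_F})`. [cite: SilvermanAEC2009, IV.2.3] -/
def negSeq (u : ℕ → (maxNilIdealC F).toIdeal) (n : ℕ) : (maxNilIdealC F).toIdeal := (-(⟨u n⟩ : W.Pt (maxNilIdealC F))).val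

/-- `⊖u` is `[p]`-compatible (`p • (−P) = −(p • P)`). [cite: SilvermanAEC2009, IV.2.3] -/
theorem mulPC_negSeq {u : ℕ → (maxNilIdealC F).toIdeal} (hup : ∀ n, mulPC F p W (u (n + 1)) = u n) (n : ℕ) :
    mulPC F p W (negSeq W u (n + 1)) = negSeq W u n := by
  have hP : p • (⟨u (n + 1)⟩ : W.Pt (maxNilIdealC F)) = ⟨u n⟩ := WeierstrassCurve.Pt.ext ((val_p_nsmul F W _).trans (hup n))
  rw [negSeq, negSeq, ← val_p_nsmul, neg_nsmul, hP]

/-- `u ⊕ (⊖u) = 0` termwise. [cite: SilvermanAEC2009, IV.2.3] -/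
theorem addSeq_negSeq (u : ℕ → (maxNilIdealC F).toIdeal) : addSeq F W u (negSeq W u) = 0 := by
  funext n
  exact congrArg WeierstrassCurve.Pt.val (add_neg_cancel (⟨u n⟩ : W.Pt (maxNilIdealC F)))

/-- The zero sequence is `[p]`-compatible. [cite: SilvermanAEC2009, IV.2.3] -/
theorem mulPC_zeroSeq (n : ℕ) : mulPC F p W ((0 : ℕ → (maxNilIdealC F).toIdeal) (n + 1)) = (0 : ℕ → (maxNilIdealC F).toIdeal) n :=
  mulPC_zero W

/-- **The Kummer torsion sequence** of `σ ∈ Γ_F` along the sequence `u`: `κ_u(σ)ₙ := σuₙ ⊖_W uₙ ∈ Ŵ(𝔪_{ℂ_F})`.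
[cite: BlochKato1990, Ex. 3.10.1] [cite: SilvermanAEC2009, VIII.§2] -/
def kummerSeq (σ : absoluteGaloisGroup F) (u : ℕ → (maxNilIdealC F).toIdeal) (n : ℕ) : (maxNilIdealC F).toIdeal :=
  ((σ • (⟨u n⟩ : W.Pt (maxNilIdealC F))) - ⟨u n⟩).val

/-- `κ_u(σ) = σu ⊕ (⊖u)` termwise. [cite: SilvermanAEC2009, IV.2.3] -/
theorem kummerSeq_eq_addSeq (σ : absoluteGaloisGroup F) (u : ℕ → (maxNilIdealC F).toIdeal) :
    kummerSeq W σ u = addSeq F W (galSeq F σ u) (negSeq W u) := by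
  funext n
  rw [kummerSeq, sub_eq_add_neg]
  rfl

/-- **`κ_u(σ)` is `[p]`-compatible** for a `[p]`-division sequence `u` (`p • (σP − P) = σ(p • P) − p • P`).
[cite: SilvermanAEC2009, IV.2.3] -/
theorem mulPC_kummerSeq (σ : absoluteGaloisGroup F) {u : ℕ → (maxNilIdealC F).toIdeal}
    (hup : ∀ n, mulPC F p W (u (n + 1)) = u n) (n : ℕ) : mulPC F p W (kummerSeq W σ u (n + 1)) = kummerSeq W σ u n := by
  have hP : p • (⟨u (n + 1)⟩ : W.Pt (maxNilIdealC F)) = ⟨u n⟩ := WeierstrassCurve.Pt.ext ((val_p_nsmul F W _).trans (hup n))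
  have hσ : σ • (p • (⟨u (n + 1)⟩ : W.Pt (maxNilIdealC F))) = p • (σ • (⟨u (n + 1)⟩ : W.Pt (maxNilIdealC F))) :=
    map_nsmul (DistribSMul.toAddMonoidHom (W.Pt (maxNilIdealC F)) σ) p _
  rw [kummerSeq, kummerSeq, ← val_p_nsmul, nsmul_sub, ← hσ, hP]

/-- **`κ_u(σ)₀ = 0` when `u₀` is fixed by `σ`** (e.g. `u₀ ∈ Ŵ(𝔪_F)` an `F`-rational point). [cite: BlochKato1990, Ex. 3.10.1] -/
theorem coe_kummerSeq_zero (σ : absoluteGaloisGroup F) {u : ℕ → (maxNilIdealC F).toIdeal}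
    (hu₀ : galCBall σ (u 0 : CBall F) = u 0) : ((kummerSeq W σ u 0 : (maxNilIdealC F).toIdeal) : CBall F) = 0 := by
  have h : σ • (⟨u 0⟩ : W.Pt (maxNilIdealC F)) = ⟨u 0⟩ :=
    WeierstrassCurve.Pt.ext (Subtype.ext (by rw [smul_def, coe_val_galPt]; exact hu₀))
  rw [kummerSeq, h, sub_self, WeierstrassCurve.Pt.val_zero]
  rfl

end PointsC

/-! ## §2 Fontaine's integral `[ũ] ∈ Ŵ(𝔫)` of a division sequence -/

section Integral

variable {F : Type} [Field F] [ValuativeRel F] [TopologicalSpace F] [IsNonarchimedeanLocalField F] [CharZero F]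
  {p : ℕ} [Fact p.Prime] [Fact (¬ IsUnit (p : integerC F))] [IsAdicComplete (Ideal.span {(p : integerC F)}) (integerC F)]
  {hθ : Function.Surjective (fontaineTheta (integerC F) p)}
  (W : WeierstrassCurve ℤ)

/-- **Fontaine's element of a `[p]`-division sequence `u` as a point of `Ŵ(𝔫)`**, `𝔫 = θ⁻¹(𝔪_{ℂ_F}) ⊂ 𝔸_inf(F)`:
`[ũ] = lim [pⁿ]_W(ûₙ)` (the tree's `torsionLift`, whose construction does not use `u₀ = 0`). [cite: FontaineAsterisque223III, Exp. II §1.2.2] -/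
def divisionLiftPt (hθ : Function.Surjective (fontaineTheta (integerC F) p)) (u : ℕ → (maxNilIdealC F).toIdeal)
    (hup : ∀ n, mulPC F p W (u (n + 1)) = u n) : W.Pt (nilTheta F p hθ) :=
  ⟨⟨torsionLift W hθ u hup, flim_mem_nilTheta _ _⟩⟩

/-- Unfolding `divisionLiftPt`. [cite: FontaineAsterisque223III, Exp. II §1.2.2] -/
@[simp] theorem coe_val_divisionLiftPt (u : ℕ → (maxNilIdealC F).toIdeal) (hup : ∀ n, mulPC F p W (u (n + 1)) = u n) :
    ((divisionLiftPt W hθ u hup).val : AinfTop F p) = torsionLift W hθ u hup := rfl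

/-- Congruence in the sequence. [cite: FontaineAsterisque223III, Exp. II §1.2.2] -/
theorem divisionLiftPt_congr {u u' : ℕ → (maxNilIdealC F).toIdeal} (h : u = u')
    (hup : ∀ n, mulPC F p W (u (n + 1)) = u n) (hup' : ∀ n, mulPC F p W (u' (n + 1)) = u' n) :
    divisionLiftPt W hθ u hup = divisionLiftPt W hθ u' hup' := by subst h; rfl

/-- **`θ([ũ]) = u₀`**: Fontaine's integral of a division sequence of `P = u₀` lifts `P` (`θ([pⁿ]ûₙ) = [pⁿ]uₙ = u₀` for all `n`).
[cite: FontaineAsterisque223III, Exp. II §1.2.2] -/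
theorem thetaPt_divisionLiftPt (u : ℕ → (maxNilIdealC F).toIdeal) (hup : ∀ n, mulPC F p W (u (n + 1)) = u n) :
    thetaPt W hθ (divisionLiftPt W hθ u hup) = ⟨u 0⟩ :=
  WeierstrassCurve.Pt.ext (Subtype.ext (by
    rw [coe_val_thetaPt, coe_val_divisionLiftPt]
    exact theta_torsionLiftShift W (hθ := hθ) hup 0))

/-- **`Γ_F`-equivariance: `σ[ũ] = [σu]`.** [cite: FontaineAsterisque223III, Exp. II §1.2] -/
theorem galPtN_divisionLiftPt (σ : absoluteGaloisGroup F) (u : ℕ → (maxNilIdealC F).toIdeal)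
    (hup : ∀ n, mulPC F p W (u (n + 1)) = u n) :
    galPtN W hθ σ (divisionLiftPt W hθ u hup) = divisionLiftPt W hθ (galSeq F σ u) (mulPC_galSeq W hθ σ hup) :=
  WeierstrassCurve.Pt.ext (Subtype.ext (by
    rw [coe_val_galPtN, coe_val_divisionLiftPt, coe_val_divisionLiftPt, gal_torsionLift W σ hup]))

/-- **Additivity: `[u ⊕_W u'] = [ũ] + [ũ']` in the group `Ŵ(𝔫)`** (`torsionLift_addSeq`). [cite: FontaineAsterisque223III, Exp. II §1.2.2]
[cite: SilvermanAEC2009, IV.2.3] -/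
theorem divisionLiftPt_addSeq {u u' : ℕ → (maxNilIdealC F).toIdeal} (hup : ∀ n, mulPC F p W (u (n + 1)) = u n)
    (hup' : ∀ n, mulPC F p W (u' (n + 1)) = u' n) :
    divisionLiftPt W hθ (addSeq F W u u') (mulPC_addSeq W hup hup') = divisionLiftPt W hθ u hup + divisionLiftPt W hθ u' hup' :=
  WeierstrassCurve.Pt.ext (Subtype.ext (by
    rw [val_add_N, coe_val_divisionLiftPt]
    exact torsionLift_addSeq W (hθ := hθ) hup hup'))

/-- `[p]_W(0) = 0` on `Ŵ(𝔫)` (`p • O = O` in the group). [cite: SilvermanAEC2009, IV.2.3] -/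
theorem mulP_zero : mulP W (0 : (nilTheta F p hθ).toIdeal) = 0 := by
  have h := val_p_nsmul_N W (hθ := hθ) (0 : W.Pt (nilTheta F p hθ))
  rw [nsmul_zero] at h
  exact h.symm

/-- **`[0] = 0`**: Fontaine's element of the zero sequence vanishes (the approximants `[pⁿ](0)` are all `0`).
[cite: FontaineAsterisque223III, Exp. II §1.2.2] -/
theorem divisionLiftPt_zero (hup : ∀ n, mulPC F p W ((0 : ℕ → (maxNilIdealC F).toIdeal) (n + 1)) = (0 : ℕ → (maxNilIdealC F).toIdeal) n) :
    divisionLiftPt W hθ 0 hup = 0 := by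
  apply WeierstrassCurve.Pt.ext
  apply Subtype.ext
  rw [coe_val_divisionLiftPt, WeierstrassCurve.Pt.val_zero, ZeroMemClass.coe_zero]
  have hu : ∀ n, theta F p ((fun _ : ℕ => (0 : (nilTheta F p hθ).toIdeal)) n : AinfTop F p) =
      (0 : ℕ → (maxNilIdealC F).toIdeal) n := fun n => by
    rw [Pi.zero_apply, ZeroMemClass.coe_zero, ZeroMemClass.coe_zero, map_zero]
  refine (torsionLift_eq_flim W hup hu).trans ?_
  have happ : ∀ n, approx (mulP W) (fun _ : ℕ => (0 : (nilTheta F p hθ).toIdeal)) n = 0 := fun n => by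
    rw [approx_def, Function.iterate_fixed (mulP_zero W (hθ := hθ)) n, ZeroMemClass.coe_zero]
  have h := tendsto_approx_flim (isContracting_mulP (hθ := hθ) W) (mulP_lift_sub_mem W hup hu)
  have hfun : approx (mulP W) (fun _ : ℕ => (0 : (nilTheta F p hθ).toIdeal)) = fun _ => 0 := funext happ
  rw [hfun] at h
  exact tendsto_nhds_unique h tendsto_const_nhds

/-- **`[⊖u] = −[ũ]`** in `Ŵ(𝔫)`. [cite: FontaineAsterisque223III, Exp. II §1.2.2] -/
theorem divisionLiftPt_negSeq {u : ℕ → (maxNilIdealC F).toIdeal} (hup : ∀ n, mulPC F p W (u (n + 1)) = u n) :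
    divisionLiftPt W hθ (negSeq W u) (mulPC_negSeq W hup) = -divisionLiftPt W hθ u hup := by
  have hsum := divisionLiftPt_addSeq W (hθ := hθ) hup (mulPC_negSeq W hup)
  rw [divisionLiftPt_congr W (addSeq_negSeq W u) (mulPC_addSeq W hup (mulPC_negSeq W hup)) (mulPC_zeroSeq W),
    divisionLiftPt_zero] at hsum
  exact (neg_eq_of_add_eq_zero_right hsum.symm).symm

/-- **`(σ − 1)[ũ] = [κ_u(σ)]` in `Ŵ(𝔫)`**: Fontaine's element of the Kummer torsion sequence of `σ` along `u` is the Galois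
coboundary `σ[ũ] − [ũ]` of the integral of `u` (equivariance + additivity of Fontaine's integration). The first step of «Kummer
classes die in `H¹(F, B⁺_dR ⊗ V)`» and of Kato II Lemma 1.4.3. [cite: FontaineAsterisque223III, Exp. II §1.2.2] [cite: BlochKato1990, Ex. 3.10.1]
[cite: Kato1993LNM1553, Ch. II Lemma 1.4.3] -/
theorem divisionLiftPt_kummerSeq (σ : absoluteGaloisGroup F) {u : ℕ → (maxNilIdealC F).toIdeal}
    (hup : ∀ n, mulPC F p W (u (n + 1)) = u n) :
    divisionLiftPt W hθ (kummerSeq W σ u) (mulPC_kummerSeq W σ hup) =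
      galPtN W hθ σ (divisionLiftPt W hθ u hup) - divisionLiftPt W hθ u hup := by
  rw [divisionLiftPt_congr W (kummerSeq_eq_addSeq W σ u) (mulPC_kummerSeq W σ hup)
      (mulPC_addSeq W (mulPC_galSeq W hθ σ hup) (mulPC_negSeq W hup)),
    divisionLiftPt_addSeq W (mulPC_galSeq W hθ σ hup) (mulPC_negSeq W hup), divisionLiftPt_negSeq W hup,
    galPtN_divisionLiftPt, sub_eq_add_neg]

/-- The same on the underlying elements of `𝔸_inf`: `[κ_u(σ)] = (σ[ũ] − [ũ]).val`. [cite: FontaineAsterisque223III, Exp. II §1.2.2] -/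
theorem torsionLift_kummerSeq (σ : absoluteGaloisGroup F) {u : ℕ → (maxNilIdealC F).toIdeal}
    (hup : ∀ n, mulPC F p W (u (n + 1)) = u n) :
    torsionLift W hθ (kummerSeq W σ u) (mulPC_kummerSeq W σ hup) =
      ((galPtN W hθ σ (divisionLiftPt W hθ u hup) - divisionLiftPt W hθ u hup).val : AinfTop F p) := by
  rw [← divisionLiftPt_kummerSeq, coe_val_divisionLiftPt]

/-! ## §3 The Kummer cocycle `Γ_F → T_pŴ(𝒪_{ℂ_F})` of a division sequence with `Γ_F`-fixed `u₀` -/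

/-- **The Kummer cocycle `σ ↦ κ_u(σ) ∈ T_pŴ(𝒪_{ℂ_F})`** of a division sequence `u` whose base point `u₀` is `Γ_F`-fixed.
[cite: BlochKato1990, Ex. 3.10.1] [cite: SilvermanAEC2009, VIII.§2] -/
def kummerCocycle (u : ℕ → (maxNilIdealC F).toIdeal) (hup : ∀ n, mulPC F p W (u (n + 1)) = u n)
    (hu₀ : ∀ σ : absoluteGaloisGroup F, galCBall σ (u 0 : CBall F) = u 0) (σ : absoluteGaloisGroup F) : TatePt F p W :=
  ofSeq W (kummerSeq W σ u) (coe_kummerSeq_zero W σ (hu₀ σ)) (mulPC_kummerSeq W σ hup)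

variable {u : ℕ → (maxNilIdealC F).toIdeal} {hup : ∀ n, mulPC F p W (u (n + 1)) = u n}
  {hu₀ : ∀ σ : absoluteGaloisGroup F, galCBall σ (u 0 : CBall F) = u 0}

omit [CharZero F] [Fact p.Prime] [Fact (¬ IsUnit (p : integerC F))] [IsAdicComplete (Ideal.span {(p : integerC F)}) (integerC F)] in
/-- Components of the Kummer cocycle: `κ_u(σ)ₙ = σuₙ − uₙ` in `Ŵ(𝔪_{ℂ_F})`. [cite: BlochKato1990, Ex. 3.10.1] -/
theorem proj_kummerCocycle (σ : absoluteGaloisGroup F) (n : ℕ) :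
    TateModule.proj p n (kummerCocycle W u hup hu₀ σ) = σ • (⟨u n⟩ : W.Pt (maxNilIdealC F)) - ⟨u n⟩ :=
  WeierstrassCurve.Pt.ext rfl

omit [CharZero F] [Fact p.Prime] [Fact (¬ IsUnit (p : integerC F))] [IsAdicComplete (Ideal.span {(p : integerC F)}) (integerC F)] in
/-- `seq (κ_u σ) = kummerSeq σ u`. [cite: BlochKato1990, Ex. 3.10.1] -/
theorem seq_kummerCocycle (σ : absoluteGaloisGroup F) : seq W (kummerCocycle W u hup hu₀ σ) = kummerSeq W σ u := rfl

omit [CharZero F] [Fact p.Prime] [Fact (¬ IsUnit (p : integerC F))] [IsAdicComplete (Ideal.span {(p : integerC F)}) (integerC F)] in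
/-- **The cocycle law `κ_u(στ) = κ_u(σ) + σ • κ_u(τ)`** (`(στ)P − P = (σP − P) + σ(τP − P)` levelwise).
[cite: SilvermanAEC2009, VIII.§2] [cite: BlochKato1990, Ex. 3.10.1] -/
theorem kummerCocycle_mul (σ τ : absoluteGaloisGroup F) :
    kummerCocycle W u hup hu₀ (σ * τ) = kummerCocycle W u hup hu₀ σ + σ • kummerCocycle W u hup hu₀ τ :=
  TateModule.ext fun n => by
    rw [map_add, TateModule.proj_smul_of_distribMulAction, proj_kummerCocycle, proj_kummerCocycle, proj_kummerCocycle,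
      mul_smul, smul_sub]
    abel

omit [CharZero F] [Fact p.Prime] [Fact (¬ IsUnit (p : integerC F))] [IsAdicComplete (Ideal.span {(p : integerC F)}) (integerC F)] in
/-- `κ_u(1) = 0`. [cite: SilvermanAEC2009, VIII.§2] -/
theorem kummerCocycle_one : kummerCocycle W u hup hu₀ 1 = 0 :=
  TateModule.ext fun n => by rw [proj_kummerCocycle, one_smul, sub_self, map_zero]

/-- **`torsionLiftHom (κ_u σ) = σ[ũ] − [ũ]`**: Fontaine's element of the Kummer cocycle is the Galois coboundary of the integral of
the division sequence, in the group `Ŵ(𝔫)`. [cite: FontaineAsterisque223III, Exp. II §1.2.2] [cite: Kato1993LNM1553, Ch. II Lemma 1.4.3] -/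
theorem torsionLiftHom_kummerCocycle (σ : absoluteGaloisGroup F) :
    torsionLiftHom W hθ (kummerCocycle W u hup hu₀ σ) =
      galPtN W hθ σ (divisionLiftPt W hθ u hup) - divisionLiftPt W hθ u hup := by
  rw [← divisionLiftPt_kummerSeq]
  exact WeierstrassCurve.Pt.ext (Subtype.ext (by rw [coe_val_torsionLiftHom, coe_val_divisionLiftPt]; rfl))

end Integral

end AinfTop

end Literature.NumberTheory.PAdicHodge

end
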